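import Literature.NumberTheory.Transcendental.RoySmallValueOperators
import Literature.NumberTheory.Transcendental.RoySmallValueTheta
import HarnessLib

/-!
# Roy's small value estimate for `𝔾ₐ × 𝔾ₘ` — Proposition 3.3 (interpolation estimate), quantitative half

Topic `Literature/NumberTheory/Transcendental`. Fourth instalment of the formalisation of the proof
of Roy 2013, Theorem 1.1 (named fact `roy2013_thm_1_1`, `RoySmallValueEstimates.lean`), after
`RoySmallValueBasic.lean` (𝒟, τ_γ, Lemma 3.1), `RoySmallValueTheta.lean` (Lemma 3.2) and
`RoySmallValueOperators.lean` (polynomials in `𝒟` on monomials). Source: D. Roy, *A small value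
estimate for `𝔾ₐ × 𝔾ₘ`*, Mathematika 59 (2013) 333–363 = arXiv:1301.0663, §3, Proposition 3.3 and
its proof (pp. 8–9 of the arXiv text):

> **Proposition 3.3.** Let `γ = (ξ, η) ∈ 𝒢`, `L ∈ ℕ`, `M = binom(L+2, 2)`. Then
> `ℂ[X]_L → ℂ^M, Q ↦ (𝒟ⁱQ(1, γ))_{0 ≤ i < M}` is an isomorphism, and for each `Q ∈ ℂ[X]_L`,
> `𝓛(Q) ≤ c₁(-γ)^L 8^M max_{0 ≤ i < M} |𝒟ⁱQ(1, γ)|`.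

This file proves the ESTIMATE (second assertion), following the printed proof step by step, with
Roy's constant `c₁(-γ)^L 8^M` replaced by `(3(1 + |ξ| + |η|⁻¹))^L (4(L+1))^M` — the shape
`c(γ)^L e^{O(M log M)}` is all that is used later in the paper (it is absorbed by the
`N^{6T log N}` of Proposition 3.7 and by the hypothesis `2T log c₆ ≤ Y` of Proposition 6.1, whose
verification in §7 only needs `T log T = o(D^β)`); we do not reproduce the factorial bookkeeping
of Roy's (3.4)–(3.5):

* `exists_extractor` — for `r + s ≤ L`, Roy's polynomial `b = b_{r,s}` of degree `< M` with
  `j! · [Yʲ] b(Y + k) = δ_{(j,k),(r,s)}` for all `j + k ≤ L` (constructed, as printed, as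
  `b = (1/r!)(Y-s)^r a(Y-s) ∏_{k ≠ s} ((Y-k)/(s-k))^{L-k+1}` with `a` from Lemma 3.2), and
  `𝓛(b) ≤ (4(L+1))^M`;
* `aeval_e_polyD_eq_coeff` — hence `(b_{r,s}(𝒟) Q)(1, 0, 1) = q_{r,s}`, the coefficient of
  `X₀^{L-r-s} X₁^r X₂^s` in `Q ∈ ℂ[X]_L` (Roy: `(b(τ)u)_0 = q_{r,s}`);
* `norm_coeff_le_of_iterate_homD_e`, `maxNorm_le_of_iterate_homD_e` — the case `γ = e`:
  `‖Q‖ ≤ (4(L+1))^M max_{i<M} |𝒟ⁱQ(1, e)|`;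
* `l1Norm_le_of_iterate_homD` — the general case through `τ_γ` (Lemma 3.1):
  `𝓛(Q) ≤ (3(1 + |ξ| + |η|⁻¹))^L (4(L+1))^M max_{i<M} |𝒟ⁱQ(1, γ)|`.

The isomorphism (first assertion) and Corollary 3.4 are in the sequel. Everything here is proved;
no definitions, no new named facts.

## References

* [Roy2013] D. Roy, *A small value estimate for 𝔾ₐ × 𝔾ₘ*, Mathematika 59 (2013), 333–363
  (arXiv:1301.0663), §3, Proposition 3.3.
-/

noncomputable section

open Polynomial Finset

namespace Literature.NumberTheory.Transcendental

namespace Roy2013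

open Nesterenko Chudnovsky

/-! ### The number `M = binom(L+2, 2)` of monomials of degree `L` -/

/-- `∑_{k ≤ L} (L - k + 1) = binom(L+2, 2)`: counting the monomials `X₀^{L-j-k} X₁^j X₂^k` by `k`.
[cite: Roy2013, §3 (proof of Proposition 3.3)] -/
theorem sum_range_sub_add_one (L : ℕ) : ∑ k ∈ range (L + 1), (L - k + 1) = (L + 2).choose 2 := by
  have h1 : ∑ k ∈ range (L + 1), (L - k + 1) = ∑ j ∈ range (L + 1), (j + 1) := by
    rw [← sum_range_reflect (fun j => j + 1) (L + 1)]
    refine sum_congr rfl fun k hk => ?_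
    rw [mem_range] at hk
    show L - k + 1 = L + 1 - 1 - k + 1
    omega
  have h2 := Finset.sum_range_id_mul_two (L + 1)
  rw [Nat.add_sub_cancel] at h2
  rw [h1, sum_add_distrib, sum_const, card_range, smul_eq_mul, mul_one, Nat.choose_two_right,
    show L + 2 - 1 = L + 1 by omega]
  symm
  apply Nat.div_eq_of_eq_mul_left two_pos
  nlinarith [h2]

/-- `M = binom(L+2, 2) ≥ 1`. [folklore] -/
theorem one_le_choose_two (L : ℕ) : 1 ≤ (L + 2).choose 2 :=
  Nat.choose_pos (by omega)

/-! ### A length bound for compositions -/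

/-- `𝓛(p ∘ q) ≤ 𝓛(p) · max(1, 𝓛(q))^{deg p}`. [folklore] -/
theorem pwnorm_comp_le (p q : ℂ[X]) :
    pwnorm (normRingSeminorm ℂ) (p.comp q) ≤
      pwnorm (normRingSeminorm ℂ) p * max 1 (pwnorm (normRingSeminorm ℂ) q) ^ p.natDegree := by
  have h1 : normRingSeminorm ℂ 1 ≤ 1 := by change ‖(1 : ℂ)‖ ≤ 1; rw [norm_one]
  rw [comp_eq_sum_left, sum_def, pwnorm_eq_sum_range _ p, sum_mul]
  refine (pwnorm_sum_le _ _ _).trans ?_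
  refine (Finset.sum_le_sum_of_subset_of_nonneg supp_subset_range_natDegree_succ
    (fun i _ _ => pwnorm_nonneg _ _)).trans (Finset.sum_le_sum fun i hi => ?_)
  refine (pwnorm_mul_le _ _ _).trans ?_
  rw [pwnorm_C]
  refine mul_le_mul_of_nonneg_left ?_ (apply_nonneg _ _)
  refine (pwnorm_pow_le _ h1 _ _).trans ?_
  calc pwnorm (normRingSeminorm ℂ) q ^ i ≤ max 1 (pwnorm (normRingSeminorm ℂ) q) ^ i :=
        pow_le_pow_left₀ (pwnorm_nonneg _ _) (le_max_right _ _) _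
    _ ≤ max 1 (pwnorm (normRingSeminorm ℂ) q) ^ p.natDegree :=
        pow_le_pow_right₀ (le_max_left _ _) (Nat.lt_succ_iff.mp (mem_range.mp hi))

/-- `𝓛(p - q) ≤ 𝓛(p) + 𝓛(q)`. [folklore] -/
theorem pwnorm_sub_le (p q : ℂ[X]) :
    pwnorm (normRingSeminorm ℂ) (p - q) ≤
      pwnorm (normRingSeminorm ℂ) p + pwnorm (normRingSeminorm ℂ) q := by
  rw [sub_eq_add_neg, ← pwnorm_neg _ q]
  exact pwnorm_add_le _ _ _

/-! ### The nodes `1/(k - s)` -/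

/-- For integers `k ≠ s`, `|1/(k - s)| ≤ 1`. [folklore] -/
theorem norm_inv_natCast_sub_le {k s : ℕ} (h : k ≠ s) : ‖((k : ℂ) - s)⁻¹‖ ≤ 1 := by
  rw [norm_inv]
  refine inv_le_one_of_one_le₀ ?_
  have hc : ((k : ℂ) - s) = (((k : ℝ) - s : ℝ) : ℂ) := by push_cast; rfl
  rw [hc, Complex.norm_real, Real.norm_eq_abs]
  rcases lt_or_gt_of_ne h with hlt | hgt
  · have : (k : ℝ) + 1 ≤ s := by exact_mod_cast hlt
    rw [abs_of_neg (by linarith)]; linarith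
  · have : (s : ℝ) + 1 ≤ k := by exact_mod_cast hgt
    rw [abs_of_pos (by linarith)]; linarith

/-- For `k ≠ s`, `(k - s) · (1/(k - s)) = 1` in `ℂ`. [folklore] -/
theorem natCast_sub_mul_inv {k s : ℕ} (h : k ≠ s) : ((k : ℂ) - s) * ((k : ℂ) - s)⁻¹ = 1 :=
  mul_inv_cancel₀ (sub_ne_zero.mpr (by exact_mod_cast h))

/-! ### Roy's polynomial `b_{r,s}` -/

/-- **The interpolation polynomials of the proof of Proposition 3.3.** For `r + s ≤ L` there is
`b ∈ ℂ[Y]` of degree `< M = binom(L+2, 2)` and length `𝓛(b) ≤ (4(L+1))^M` such that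
`j! · [Yʲ] b(Y + k) = δ_{(j,k),(r,s)}` whenever `j + k ≤ L`. (Roy:
`b = (1/r!)(Y-s)^r a(Y-s) ∏_{k≠s} ((Y-k)/(s-k))^{L-k+1}`, `a` from Lemma 3.2, `𝓛(b) ≤ 8^M`.)
[cite: Roy2013, §3, proof of Proposition 3.3] -/
theorem exists_extractor (L r s : ℕ) (hrs : r + s ≤ L) :
    ∃ b : ℂ[X], b.natDegree < (L + 2).choose 2 ∧
      pwnorm (normRingSeminorm ℂ) b ≤ (4 * (L + 1) : ℝ) ^ (L + 2).choose 2 ∧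
      ∀ j k : ℕ, j + k ≤ L →
        (j.factorial : ℂ) * (taylor (k : ℂ) b).coeff j = if j = r ∧ k = s then 1 else 0 := by
  classical
  set M : ℕ := (L + 2).choose 2 with hM
  set ks : Finset ℕ := (range (L + 1)).erase s with hks
  have hs : s ∈ range (L + 1) := mem_range.mpr (by omega)
  have hks_mem : ∀ k ∈ ks, k ≠ s ∧ k ≤ L := fun k hk => by
    rw [hks, mem_erase, mem_range] at hk
    exact ⟨hk.1, Nat.lt_succ_iff.mp hk.2⟩
  -- the exponent count `E' + (L - s + 1) = M`
  have hE : ∑ k ∈ ks, (L - k + 1) + (L - s + 1) = M := by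
    have h := sum_erase_add (range (L + 1)) (fun k => L - k + 1) hs
    rw [← hks, sum_range_sub_add_one L] at h
    rw [hM, ← h]
  -- Lemma 3.2 with `r_k = 1/(k - s)`, `e_k = L - k + 1`, `e₀ = L - r - s + 1`
  obtain ⟨a, ha_deg, ha_dvd, ha_len⟩ := exists_truncInverse ks (fun k => ((k : ℂ) - s)⁻¹)
    (fun k => L - k + 1) (e₀ := L - r - s + 1) (by omega)
    (fun k hk => norm_inv_natCast_sub_le (hks_mem k hk).1)
  set Pp : ℂ[X] := ∏ k ∈ ks, (1 - C (((k : ℂ) - s)⁻¹) * X) ^ (L - k + 1) with hPp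
  set B : ℂ[X] := C ((r.factorial : ℂ)⁻¹) * X ^ r * (a * Pp) with hB
  have h1 : normRingSeminorm ℂ 1 ≤ 1 := by change ‖(1 : ℂ)‖ ≤ 1; rw [norm_one]
  -- degree of `B`
  have hPp_deg : Pp.natDegree ≤ ∑ k ∈ ks, (L - k + 1) := by
    refine (natDegree_prod_le _ _).trans (Finset.sum_le_sum fun k _ => ?_)
    refine natDegree_pow_le.trans ?_
    have : (1 - C (((k : ℂ) - s)⁻¹) * X : ℂ[X]).natDegree ≤ 1 := by
      refine (natDegree_sub_le _ _).trans (max_le (by simp) ?_)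
      exact (natDegree_C_mul_le _ _).trans natDegree_X_le
    calc (L - k + 1) * (1 - C (((k : ℂ) - s)⁻¹) * X : ℂ[X]).natDegree ≤ (L - k + 1) * 1 :=
          Nat.mul_le_mul_left _ this
      _ = L - k + 1 := mul_one _
  have hB_deg : B.natDegree + 1 ≤ M := by
    have h := natDegree_mul_le (p := C ((r.factorial : ℂ)⁻¹) * X ^ r) (q := a * Pp)
    have h' := natDegree_mul_le (p := a) (q := Pp)
    have h'' := natDegree_C_mul_X_pow_le ((r.factorial : ℂ)⁻¹) r
    rw [← hB] at h
    omega
  refine ⟨B.comp (X - C (s : ℂ)), ?_, ?_, ?_⟩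
  · -- degree of `b`
    rw [natDegree_comp, natDegree_X_sub_C, mul_one]
    omega
  · -- length of `b`
    have hPp_len : pwnorm (normRingSeminorm ℂ) Pp ≤ (2 : ℝ) ^ ∑ k ∈ ks, (L - k + 1) := by
      rw [← prod_pow_eq_pow_sum]
      refine (pwnorm_prod_le _ h1 _ _).trans (Finset.prod_le_prod (fun _ _ => pwnorm_nonneg _ _)
        fun k hk => (pwnorm_pow_le _ h1 _ _).trans (pow_le_pow_left₀ (pwnorm_nonneg _ _) ?_ _))
      refine (pwnorm_sub_le _ _).trans ?_
      have hC : pwnorm (normRingSeminorm ℂ) (C (((k : ℂ) - s)⁻¹) * X) ≤ 1 := by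
        refine (pwnorm_mul_le _ _ _).trans ?_
        rw [pwnorm_C, pwnorm_X]
        change ‖((k : ℂ) - s)⁻¹‖ * ‖(1 : ℂ)‖ ≤ 1
        rw [norm_one, mul_one]
        exact norm_inv_natCast_sub_le (hks_mem k hk).1
      have hone : pwnorm (normRingSeminorm ℂ) (1 : ℂ[X]) ≤ 1 := by rw [pwnorm_one]; exact h1
      linarith
    have hB_len : pwnorm (normRingSeminorm ℂ) B ≤ (2 : ℝ) ^ M * 2 ^ M := by
      rw [hB]
      refine (pwnorm_mul_le _ _ _).trans ?_
      have hCX : pwnorm (normRingSeminorm ℂ) (C ((r.factorial : ℂ)⁻¹) * X ^ r) ≤ 1 := by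
        refine (pwnorm_mul_le _ _ _).trans ?_
        rw [pwnorm_C]
        refine mul_le_one₀ ?_ (pwnorm_nonneg _ _) ((pwnorm_pow_le _ h1 _ _).trans ?_)
        · change ‖((r.factorial : ℂ))⁻¹‖ ≤ 1
          rw [norm_inv, Complex.norm_natCast]
          exact inv_le_one_of_one_le₀
            (by exact_mod_cast Nat.one_le_iff_ne_zero.mpr r.factorial_ne_zero)
        · rw [pwnorm_X]
          change ‖(1 : ℂ)‖ ^ r ≤ 1
          rw [norm_one, one_pow]
      refine (mul_le_mul hCX ((pwnorm_mul_le _ _ _).trans (mul_le_mul ha_len hPp_len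
        (pwnorm_nonneg _ _) (by positivity))) (pwnorm_nonneg _ _) zero_le_one).trans ?_
      rw [one_mul]
      exact mul_le_mul (pow_le_pow_right₀ one_le_two (by omega))
        (pow_le_pow_right₀ one_le_two (by omega)) (by positivity) (by positivity)
    refine (pwnorm_comp_le _ _).trans ?_
    have hq : max 1 (pwnorm (normRingSeminorm ℂ) (X - C (s : ℂ))) ≤ L + 1 := by
      refine max_le (by linarith) ((pwnorm_X_sub_C_le _ _).trans ?_)
      change ‖(1 : ℂ)‖ + ‖(s : ℂ)‖ ≤ L + 1
      rw [norm_one, Complex.norm_natCast]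
      have : (s : ℝ) ≤ L := by exact_mod_cast (show s ≤ L by omega)
      linarith
    calc pwnorm (normRingSeminorm ℂ) B *
          max 1 (pwnorm (normRingSeminorm ℂ) (X - C (s : ℂ))) ^ B.natDegree
        ≤ ((2 : ℝ) ^ M * 2 ^ M) * ((L : ℝ) + 1) ^ M := by
          refine mul_le_mul hB_len ?_ (by positivity) (by positivity)
          calc max 1 (pwnorm (normRingSeminorm ℂ) (X - C (s : ℂ))) ^ B.natDegree
              ≤ ((L : ℝ) + 1) ^ B.natDegree :=
                pow_le_pow_left₀ (le_trans zero_le_one (le_max_left _ _)) hq _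
            _ ≤ ((L : ℝ) + 1) ^ M := pow_le_pow_right₀ (by linarith) (by omega)
      _ = (4 * (L + 1) : ℝ) ^ M := by rw [← mul_pow, ← mul_pow]; norm_num
  · -- the Taylor coefficients
    intro j k hjk
    have htay : taylor (k : ℂ) (B.comp (X - C (s : ℂ))) = taylor ((k : ℂ) - s) B := by
      rw [taylor_apply, taylor_apply, comp_assoc, sub_comp, X_comp, C_comp, add_sub_assoc,
        ← C_sub]
    rw [htay]
    by_cases hk : k = s
    · -- `k = s`: `taylor 0 B = B = (1/r!) Y^r (1 + O(Y^{e₀}))`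
      rw [hk, sub_self, taylor_zero, hB, mul_assoc, coeff_C_mul, coeff_X_pow_mul']
      have hcoeff : ∀ i < L - r - s + 1, (a * Pp).coeff i = if i = 0 then 1 else 0 := by
        intro i hi
        have := (X_pow_dvd_iff.mp ha_dvd) i hi
        rwa [coeff_sub, coeff_one, sub_eq_zero] at this
      rcases eq_or_ne j r with rfl | hjr
      · rw [if_pos le_rfl, Nat.sub_self, hcoeff 0 (by omega), if_pos rfl, mul_one,
          if_pos ⟨rfl, rfl⟩, mul_inv_cancel₀ (by exact_mod_cast Nat.factorial_ne_zero _)]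
      · rw [if_neg (show ¬(j = r ∧ s = s) from fun h => hjr h.1)]
        by_cases hrj : r ≤ j
        · rw [if_pos hrj, hcoeff (j - r) (by omega), if_neg (by omega), mul_zero, mul_zero]
        · rw [if_neg hrj, mul_zero, mul_zero]
    · -- `k ≠ s`: `(Y - k)^{L-k+1}` divides `b`, i.e. `Y^{L-k+1}` divides `b(Y + k)`
      rw [if_neg (show ¬(j = r ∧ k = s) from fun h => hk h.2)]
      have hk_mem : k ∈ ks := by
        rw [hks, mem_erase, mem_range]; exact ⟨hk, by omega⟩
      have hP : (1 - C (((k : ℂ) - s)⁻¹) * X) ^ (L - k + 1) ∣ Pp := by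
        rw [hPp]
        exact dvd_prod_of_mem (fun i : ℕ => (1 - C (((i : ℂ) - s)⁻¹) * X) ^ (L - i + 1)) hk_mem
      have hdvd : (1 - C (((k : ℂ) - s)⁻¹) * X) ^ (L - k + 1) ∣ B := by
        rw [hB]
        exact (hP.mul_left a).mul_left _
      obtain ⟨c, hc⟩ := hdvd
      have hdvd' : taylor ((k : ℂ) - s) ((1 - C (((k : ℂ) - s)⁻¹) * X) ^ (L - k + 1)) ∣
          taylor ((k : ℂ) - s) B := ⟨taylor ((k : ℂ) - s) c, by rw [hc, taylor_mul]⟩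
      have hlin : taylor ((k : ℂ) - s) (1 - C (((k : ℂ) - s)⁻¹) * X) =
          C (-((k : ℂ) - s)⁻¹) * X := by
        rw [taylor_apply, sub_comp, one_comp, mul_comp, C_comp, X_comp, mul_add, ← C_mul,
          inv_mul_cancel₀ (sub_ne_zero.mpr (by exact_mod_cast hk)), C_1, C_neg]
        ring
      rw [taylor_pow, hlin, mul_pow, ← C_pow] at hdvd'
      have hX : X ^ (L - k + 1) ∣ taylor ((k : ℂ) - s) B := (dvd_mul_left _ _).trans hdvd'
      rw [(X_pow_dvd_iff.mp hX) j (by omega), mul_zero]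

/-! ### Extraction of the coefficient `q_{r,s}` -/

/-- The exponent `(L - r - s, r, s)` of the monomial `X₀^{L-r-s} X₁^r X₂^s`. For a monomial `X^ν` of
degree `L`, `(ν₁, ν₂) = (r, s)` iff `ν = (L - r - s, r, s)`. [folklore] -/
theorem eq_rsIndex_iff {L : ℕ} {ν : Fin 3 →₀ ℕ} (hν : ν.degree = L) (r s : ℕ) :
    (ν 1 = r ∧ ν 2 = s) ↔ ν = Finsupp.equivFunOnFinite.symm ![L - r - s, r, s] := by
  rw [Finsupp.degree_eq_sum, Fin.sum_univ_three] at hν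
  constructor
  · rintro ⟨h1, h2⟩
    ext i
    fin_cases i
    · simp; omega
    · simp [h1]
    · simp [h2]
  · intro h
    rw [h]
    simp

/-- **`(b_{r,s}(𝒟) Q)(1, 0, 1) = q_{r,s}`**: Roy's polynomial extracts the coefficient of
`X₀^{L-r-s} X₁^r X₂^s` from `Q ∈ ℂ[X]_L` (Roy: `|q_{r,s}| = |(b(τ)u)_0|`).
[cite: Roy2013, §3, proof of Proposition 3.3] -/
theorem aeval_e_polyD_eq_coeff {L : ℕ} {Q : CX} (hQ : Q.IsHomogeneous L) {b : ℂ[X]} {r s : ℕ}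
    (hb : ∀ j k : ℕ, j + k ≤ L →
      (j.factorial : ℂ) * (taylor (k : ℂ) b).coeff j = if j = r ∧ k = s then 1 else 0) :
    MvPolynomial.aeval ![(1 : ℂ), 0, 1] (aeval (homD : CX →ₗ[ℂ] CX) b Q) =
      Q.coeff (Finsupp.equivFunOnFinite.symm ![L - r - s, r, s]) := by
  classical
  conv_lhs => rw [Q.as_sum, map_sum, map_sum]
  have key : ∀ ν ∈ Q.support,
      MvPolynomial.aeval ![(1 : ℂ), 0, 1] (aeval (homD : CX →ₗ[ℂ] CX) b
        (MvPolynomial.monomial ν (Q.coeff ν))) =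
      if ν = Finsupp.equivFunOnFinite.symm ![L - r - s, r, s] then Q.coeff ν else 0 := by
    intro ν hν
    have hdeg : ν.degree = L := by
      rw [Finsupp.degree_eq_weight_one]; exact hQ (MvPolynomial.mem_support_iff.mp hν)
    have hνL : ν 1 + ν 2 ≤ L := by
      rw [Finsupp.degree_eq_sum, Fin.sum_univ_three] at hdeg; omega
    rw [aeval_e_polyD_monomial, mul_assoc, hb _ _ hνL]
    by_cases h : ν 1 = r ∧ ν 2 = s
    · rw [if_pos h, if_pos ((eq_rsIndex_iff hdeg r s).mp h), mul_one]
    · rw [if_neg h, if_neg (fun h' => h ((eq_rsIndex_iff hdeg r s).mpr h')), mul_zero]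
  rw [Finset.sum_congr rfl key, Finset.sum_ite_eq']
  split_ifs with h
  · rfl
  · exact (MvPolynomial.notMem_support_iff.mp h).symm

/-! ### Proposition 3.3, the estimate, at `γ = e` -/

/-- **Proposition 3.3 at `γ = e = (0, 1)`, coefficientwise**: for `Q ∈ ℂ[X]_L` and
`M = binom(L+2, 2)`, every coefficient of `Q` is at most `(4(L+1))^M max_{i<M} |𝒟ⁱQ(1, 0, 1)|`.
[cite: Roy2013, Proposition 3.3] -/
theorem norm_coeff_le_of_iterate_homD_e {L : ℕ} {Q : CX} (hQ : Q.IsHomogeneous L) {B₀ : ℝ}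
    (hB : ∀ n < (L + 2).choose 2, ‖MvPolynomial.aeval ![(1 : ℂ), 0, 1] (homD^[n] Q)‖ ≤ B₀)
    (ν : Fin 3 →₀ ℕ) :
    ‖Q.coeff ν‖ ≤ (4 * (L + 1) : ℝ) ^ (L + 2).choose 2 * B₀ := by
  have hB0 : 0 ≤ B₀ := (norm_nonneg _).trans (hB 0 (one_le_choose_two L))
  by_cases hν : ν ∈ Q.support
  · have hdeg : ν.degree = L := by
      rw [Finsupp.degree_eq_weight_one]; exact hQ (MvPolynomial.mem_support_iff.mp hν)
    have hνL : ν 1 + ν 2 ≤ L := by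
      rw [Finsupp.degree_eq_sum, Fin.sum_univ_three] at hdeg; omega
    obtain ⟨b, hb_deg, hb_len, hb⟩ := exists_extractor L (ν 1) (ν 2) hνL
    have hν' : ν = Finsupp.equivFunOnFinite.symm ![L - ν 1 - ν 2, ν 1, ν 2] :=
      (eq_rsIndex_iff hdeg _ _).mp ⟨rfl, rfl⟩
    rw [hν', ← aeval_e_polyD_eq_coeff hQ hb]
    refine (norm_aeval_polyD_le b Q 0 1 fun n hn => hB n (by omega)).trans ?_
    exact mul_le_mul_of_nonneg_right hb_len hB0
  · rw [MvPolynomial.notMem_support_iff.mp hν, norm_zero]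
    positivity

/-- **Proposition 3.3 at `γ = e`**: `‖Q‖ ≤ (4(L+1))^M max_{i<M} |𝒟ⁱQ(1, 0, 1)|` for
`Q ∈ ℂ[X]_L` (Roy: `‖Q‖ ≤ 8^M max_{i<M} |𝒟ⁱQ(1, e)|`). [cite: Roy2013, Proposition 3.3] -/
theorem maxNorm_le_of_iterate_homD_e {L : ℕ} {Q : CX} (hQ : Q.IsHomogeneous L) {B₀ : ℝ}
    (hB : ∀ n < (L + 2).choose 2, ‖MvPolynomial.aeval ![(1 : ℂ), 0, 1] (homD^[n] Q)‖ ≤ B₀) :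
    maxNorm Q ≤ (4 * (L + 1) : ℝ) ^ (L + 2).choose 2 * B₀ := by
  have hB0 : 0 ≤ B₀ := (norm_nonneg _).trans (hB 0 (one_le_choose_two L))
  exact maxNorm_le_of_forall_le (by positivity) fun ν _ => norm_coeff_le_of_iterate_homD_e hQ hB ν

/-! ### Proposition 3.3, the estimate, at a general point `γ = (ξ, η)` -/

/-- **Roy 2013, Proposition 3.3 (the estimate)**: for `γ = (ξ, η) ∈ ℂ × ℂˣ`, `Q ∈ ℂ[X]_L` and
`M = binom(L+2, 2)`,
`𝓛(Q) ≤ (3(1 + |ξ| + |η|⁻¹))^L (4(L+1))^M max_{0 ≤ i < M} |𝒟ⁱQ(1, γ)|`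
(Roy: `𝓛(Q) ≤ c₁(-γ)^L 8^M max_{i<M} |𝒟ⁱQ(1, γ)|`, `c₁(-γ) = 2 + |ξ| + |η|⁻¹`; proof as printed:
the case `γ = e` applied to `τ_γ Q`, then Lemma 3.1 for `τ_{-γ}`). [cite: Roy2013, Proposition 3.3] -/
theorem l1Norm_le_of_iterate_homD {L : ℕ} {Q : CX} (hQ : Q.IsHomogeneous L) {ξ η : ℂ}
    (hη : η ≠ 0) {B₀ : ℝ}
    (hB : ∀ n < (L + 2).choose 2, ‖MvPolynomial.aeval ![1, ξ, η] (homD^[n] Q)‖ ≤ B₀) :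
    l1Norm Q ≤ (3 * (1 + ‖ξ‖ + ‖η‖⁻¹)) ^ L * (4 * (L + 1) : ℝ) ^ (L + 2).choose 2 * B₀ := by
  have hB0 : 0 ≤ B₀ := (norm_nonneg _).trans (hB 0 (one_le_choose_two L))
  have hτ : maxNorm (tau ξ η Q) ≤ (4 * (L + 1) : ℝ) ^ (L + 2).choose 2 * B₀ := by
    refine maxNorm_le_of_iterate_homD_e (isHomogeneous_tau ξ η hQ) fun n hn => ?_
    rw [← tau_iterate_homD, aeval_one_tau, add_zero, mul_one]
    exact hB n hn
  calc l1Norm Q = l1Norm (tau (-ξ) η⁻¹ (tau ξ η Q)) := by rw [tau_neg_tau hη]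
    _ ≤ (3 * (1 + ‖-ξ‖ + ‖η⁻¹‖)) ^ L * maxNorm (tau ξ η Q) :=
        l1Norm_tau_le_maxNorm (isHomogeneous_tau ξ η hQ) _ _
    _ ≤ (3 * (1 + ‖ξ‖ + ‖η‖⁻¹)) ^ L * ((4 * (L + 1) : ℝ) ^ (L + 2).choose 2 * B₀) := by
        rw [norm_neg, norm_inv]
        exact mul_le_mul_of_nonneg_left hτ (by positivity)
    _ = (3 * (1 + ‖ξ‖ + ‖η‖⁻¹)) ^ L * (4 * (L + 1) : ℝ) ^ (L + 2).choose 2 * B₀ := by ring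

end Roy2013

end Literature.NumberTheory.Transcendental
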